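import Literature.Analysis.FluidPDE.AlbrittonKatoClassLocalLeray
import Literature.Analysis.FluidPDE.CalderonSplittingLp
import Literature.Analysis.FluidPDE.LongLivedOseenSolution
import Literature.Analysis.FluidPDE.RemainderEnergyClass
import Literature.Analysis.UnboundedOperators.HeatKernelGaussianData
import HarnessLib

/-!
# Albritton 2018, Prop. 4.5: the Calderón splitting of a restarted member of Albritton's class

Analysis/FluidPDE proofs file (theorems only) on the discharge path of the corrected form of
`Literature.Analysis.FluidPDE.albritton_singular_point_of_blowup` (Albritton 2018, Cor. 4.6 over
Albritton's class `IsKatoBesovMildSolutionOn`). This file assembles, for a member `u` of the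
class on `[0, T)` with unit viscosity and a time `t₀ ∈ (0, T)`, the objects of the proof of
Prop. 4.5 (arXiv:1612.04439, p. 23):

* the classical representative `v` of `u(· + t₀)` on `(-t₀/2, T - t₀)` (the accepted
  `exists_classical_of_unit`, shifted), bounded with bounded gradient on closed sub-slabs, with
  `L^p` slices, satisfying the Oseen integral identities from every time
  (`ae_eq_heatExtension_sub_oseenDuhamel` transported along a.e. equality of slices);
* the Calderón splitting `v(0) = U₀ + V₀` with `‖V₀‖_∞` so small that the long-lived factor `V`
  (`LongLivedOseenSolution.exists_longLived_classical`) lives past `T - t₀`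
  (`CalderonSplittingLp.exists_calderon_splitting_sup`);
* the energy-class bounds of the remainder `W = v − V` up to the final time
  (`RemainderEnergyClass.remainder_energy_class`).

## References

* D. Albritton, Anal. PDE 11 (2018) = arXiv:1612.04439, proof of Prop. 4.5. [Albritton2018]
* C. P. Calderón, Trans. AMS 318 (1990). [Calderon1990]
-/

noncomputable section

open MeasureTheory TemperedDistribution TopologicalSpace Set Function Filter Metric
open _root_.Topology
open scoped SchwartzMap ENNReal NNReal RealInnerProductSpace

namespace Literature.Analysis.FluidPDE

namespace AlbrittonRemainderSetup

/-- The Oseen–Duhamel term only sees the slices of the fields almost everywhere. [folklore] -/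
theorem oseenDuhamel_congr_ae_slice {ν s t : ℝ}
    {u u' : ℝ → EuclideanSpace ℝ (Fin 3) → EuclideanSpace ℝ (Fin 3)}
    (hu : ∀ τ ∈ Ioo s t, u τ =ᵐ[volume] u' τ) (x : EuclideanSpace ℝ (Fin 3)) :
    oseenDuhamel ν s u u t x = oseenDuhamel ν s u' u' t x := by
  rw [oseenDuhamel_apply, oseenDuhamel_apply]
  refine setIntegral_congr_fun measurableSet_Ioo fun τ hτ => ?_
  refine integral_congr_ae ?_
  filter_upwards [hu τ hτ] with y hy
  rw [hy]

variable {p q : ℝ≥0∞} [hp1 : Fact (1 ≤ p)] {T : ℝ}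
  {u : ℝ → EuclideanSpace ℝ (Fin 3) → EuclideanSpace ℝ (Fin 3)}
  {U : ℝ → 𝓢'(EuclideanSpace ℝ (Fin 3), EuclideanSpace ℂ (Fin 3))}

/-- **The classical representative after a restart, with its quantitative properties** (the
first half of the setup): `v` classical on `(-t₀/2, T - t₀)` with pressure `π`, `v t = u(t + t₀)`
a.e. for `t ∈ [0, T - t₀)`, bounded and with bounded gradient on every `[0, S₁]`, `S₁ < T - t₀`,
slices in `L^p` with a bound on every `[0, S₁)`, and the Oseen integral identities from every
time `s ∈ (-t₀/2, T - t₀)`. [cite: Albritton2018, Thm. 4.2 (4.3) and Prop. 4.5 proof; KochNadirashviliSereginSverak2009, Prop. 4.1] -/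
theorem exists_classical_shift (hp₃ : 3 < p) (hp : p < ⊤) (hq₁ : 1 ≤ q) (hq : q < ⊤) (hT : 0 < T)
    (h : IsKatoBesovMildSolutionOn p q T 1 u U) {t₀ : ℝ} (ht₀ : t₀ ∈ Ioo 0 T) :
    ∃ (v : ℝ → EuclideanSpace ℝ (Fin 3) → EuclideanSpace ℝ (Fin 3))
      (π : ℝ → EuclideanSpace ℝ (Fin 3) → ℝ),
      IsClassicalNSSolutionOn (Ioo (-(t₀ / 2)) (T - t₀)) 1 0 v π ∧
      (∀ t ∈ Ico 0 (T - t₀), v t =ᵐ[volume] u (t + t₀)) ∧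
      (∀ S₁, S₁ < T - t₀ → ∃ Mv : ℝ, ∀ t ∈ Icc 0 S₁, ∀ x, ‖v t x‖ ≤ Mv) ∧
      (∀ S₁, S₁ < T - t₀ → ∃ K : ℝ, ∀ t ∈ Icc 0 S₁, ∀ x, ‖fderiv ℝ (v t) x‖ ≤ K) ∧
      (∀ S₁, S₁ < T - t₀ → ∃ N : ℝ≥0, ∀ t ∈ Ioo 0 S₁, MemLp (v t) p volume ∧
        eLpNorm (v t) p volume ≤ N) ∧
      (∀ t ∈ Ico 0 (T - t₀), MemLp (v t) p volume) ∧
      ∀ s t : ℝ, -(t₀ / 2) < s → s < t → t < T - t₀ → v t =ᵐ[volume] fun x =>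
        UnboundedOperators.heatExtension (v s) (t - s) x - oseenDuhamel 1 s v v t x := by
  have hq0 : q ≠ 0 := (zero_lt_one.trans_le hq₁).ne'
  -- the classical representative from the restart at `σ = t₀/2`
  set σ : ℝ := t₀ / 2 with hσ_def
  have hσ : σ ∈ Ioo 0 T := ⟨by rw [hσ_def]; linarith [ht₀.1], by rw [hσ_def]; linarith [ht₀.1, ht₀.2]⟩
  have hσt₀ : σ < t₀ := by rw [hσ_def]; linarith [ht₀.1]
  obtain ⟨w, πw, hw, hwu⟩ := h.exists_classical_of_unit hp₃ hp hq₁ hq hT hσ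
  set O : Set ℝ := Ioo (-(t₀ / 2)) (T - t₀) with hO_def
  set v : ℝ → EuclideanSpace ℝ (Fin 3) → EuclideanSpace ℝ (Fin 3) := fun t => w (t + t₀) with hv_def
  set π : ℝ → EuclideanSpace ℝ (Fin 3) → ℝ := fun t => πw (t + t₀) with hπ_def
  have hvcl : IsClassicalNSSolutionOn O 1 0 v π := by
    have h' := hw.comp_add_right t₀
    have hset : (fun t => t + t₀) ⁻¹' Ioo σ T = O := by
      ext t
      simp only [mem_preimage, mem_Ioo, hO_def, hσ_def]
      constructor
      · rintro ⟨h1, h2⟩; exact ⟨by linarith, by linarith⟩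
      · rintro ⟨h1, h2⟩; exact ⟨by linarith, by linarith⟩
    rw [hset] at h'
    exact h'
  -- a.e. agreement with the shifted solution, on all of `O`
  have hvuO : ∀ t ∈ O, v t =ᵐ[volume] u (t + t₀) := by
    intro t ht
    have htt : t + t₀ ∈ Ioo σ T := ⟨by simp only [hO_def, mem_Ioo] at ht; rw [hσ_def]; linarith [ht.1],
      by simp only [hO_def, mem_Ioo] at ht; linarith [ht.2]⟩
    exact (hwu (t + t₀) htt).symm
  have hvu : ∀ t ∈ Ico 0 (T - t₀), v t =ᵐ[volume] u (t + t₀) := fun t ht =>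
    hvuO t ⟨by linarith [ht.1, ht₀.1], ht.2⟩
  have hIccO : ∀ {S₁ : ℝ}, S₁ < T - t₀ → Icc (0 : ℝ) S₁ ⊆ O := fun hS₁ t ht =>
    ⟨by linarith [ht.1, ht₀.1], lt_of_le_of_lt ht.2 hS₁⟩
  -- ### bounds on closed sub-slabs
  have hbounds : ∀ S₁, S₁ < T - t₀ → ∃ Mv : ℝ, ∀ t ∈ Icc 0 S₁, ∀ x, ‖v t x‖ ≤ Mv := by
    intro S₁ hS₁
    set t' : ℝ := (t₀ + S₁ + T) / 2 with ht'_def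
    have ht'T : t' < T := by rw [ht'_def]; linarith
    have hSt' : t₀ + S₁ < t' := by rw [ht'_def]; linarith
    obtain ⟨-, b, -, hb, -, hLi⟩ := h.exists_kato_bounds ht'T
    set M : ℝ := b * t₀ ^ (-(1 / 2 : ℝ)) with hM_def
    have hM0 : 0 ≤ M := by rw [hM_def]; exact mul_nonneg hb.le (Real.rpow_nonneg ht₀.1.le _)
    refine ⟨M, fun t ht => ?_⟩
    have hτ : t + t₀ ∈ Ioo 0 t' := ⟨by linarith [ht.1, ht₀.1], by linarith [ht.2]⟩
    have h1 : eLpNorm (u (t + t₀)) ⊤ volume ≤ ENNReal.ofReal M := by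
      refine (hLi _ hτ).trans (ENNReal.ofReal_le_ofReal ?_)
      rw [hM_def]
      exact mul_le_mul_of_nonneg_left
        (Real.rpow_le_rpow_of_nonpos ht₀.1 (by linarith [ht.1]) (by norm_num)) hb.le
    have h2 : ∀ᵐ x ∂(volume : Measure (EuclideanSpace ℝ (Fin 3))), ‖v t x‖ ≤ M := by
      have h3 := ae_norm_le_of_eLpNorm_top_le_ofReal hM0 h1
      have h4 : v t =ᵐ[volume] u (t + t₀) := hvu t ⟨ht.1, lt_of_le_of_lt ht.2 hS₁⟩
      filter_upwards [h3, h4] with x hx hx'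
      rw [hx']
      exact hx
    exact forall_norm_le_of_ae_norm_le_of_continuous
      (hvcl.contDiff_velocity (hIccO hS₁ ht)).continuous h2
  -- ### gradient bounds on closed sub-slabs
  have hgrads : ∀ S₁, S₁ < T - t₀ → ∃ K : ℝ, ∀ t ∈ Icc 0 S₁, ∀ x, ‖fderiv ℝ (v t) x‖ ≤ K := by
    intro S₁ hS₁
    set t' : ℝ := (t₀ + S₁ + T) / 2 with ht'_def
    have ht'T : t' < T := by rw [ht'_def]; linarith
    obtain ⟨K, hK⟩ := h.exists_forall_norm_fderiv_le hp₃ hp hq₁ hT hσ hw hwu hσt₀ ht'T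
    exact ⟨K, fun t ht x => hK (t + t₀) ⟨by linarith [ht.1], by rw [ht'_def]; linarith [ht.2]⟩ x⟩
  -- ### `L^p` slices
  have hmemp : ∀ t ∈ Ico 0 (T - t₀), MemLp (v t) p volume := by
    intro t ht
    have htt : t + t₀ ∈ Ioo 0 T := ⟨by linarith [ht.1, ht₀.1], by linarith [ht.2]⟩
    exact (h.memLp_and_memLp_top htt).1.ae_eq (hvu t ht).symm
  have hLpb : ∀ S₁, S₁ < T - t₀ → ∃ N : ℝ≥0, ∀ t ∈ Ioo 0 S₁, MemLp (v t) p volume ∧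
      eLpNorm (v t) p volume ≤ N := by
    intro S₁ hS₁
    set t' : ℝ := (t₀ + S₁ + T) / 2 with ht'_def
    have ht'T : t' < T := by rw [ht'_def]; linarith
    obtain ⟨a, -, ha, -, hLp, -⟩ := h.exists_kato_bounds ht'T
    set A : ℝ := a * t₀ ^ (-((1 - 3 / p.toReal) / 2)) with hA_def
    refine ⟨A.toNNReal, fun t ht => ⟨hmemp t ⟨ht.1.le, ht.2.trans hS₁⟩, ?_⟩⟩
    have hτ : t + t₀ ∈ Ioo 0 t' := ⟨by linarith [ht.1, ht₀.1], by rw [ht'_def]; linarith [ht.2]⟩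
    rw [eLpNorm_congr_ae (hvu t ⟨ht.1.le, ht.2.trans hS₁⟩)]
    refine (hLp _ hτ).trans ?_
    rw [← ENNReal.ofReal_coe_nnreal, Real.coe_toNNReal']
    refine ENNReal.ofReal_le_ofReal (le_trans ?_ (le_max_left _ _))
    rw [hA_def]
    have hp3r : (3 : ℝ) < p.toReal := by
      have h' := ENNReal.toReal_strict_mono hp.ne hp₃
      simpa using h'
    refine mul_le_mul_of_nonneg_left (Real.rpow_le_rpow_of_nonpos ht₀.1 (by linarith [ht.1]) ?_) ha
    have : 3 / p.toReal < 1 := (div_lt_one (by linarith)).2 hp3r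
    linarith
  -- ### the Oseen integral identities from every time `s ∈ O`
  have hO : ∀ s t : ℝ, -(t₀ / 2) < s → s < t → t < T - t₀ → v t =ᵐ[volume] fun x =>
      UnboundedOperators.heatExtension (v s) (t - s) x - oseenDuhamel 1 s v v t x := by
    intro s t hs hst htT
    have hsO : s ∈ O := ⟨hs, hst.trans htT⟩
    have htO : t ∈ O := ⟨hs.trans hst, htT⟩
    have hs0 : 0 < s + t₀ := by linarith
    have hK := h.ae_eq_heatExtension_sub_oseenDuhamel hp₃ hp hq0 hT hs0
      (by linarith : s + t₀ < t + t₀) (by linarith : t + t₀ < T)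
    -- the data: `e^{(t-s)Δ} u(s + t₀) = e^{(t-s)Δ} v(s)` everywhere
    have hheat : UnboundedOperators.heatExtension (u (s + t₀)) (t - s) =
        UnboundedOperators.heatExtension (v s) (t - s) :=
      UnboundedOperators.heatExtension_congr_ae' (hvuO s hsO).symm (t - s)
    -- the Duhamel terms: time shift and a.e. equality of the slices
    have hB : ∀ x, oseenDuhamel 1 (s + t₀) u u (t + t₀) x = oseenDuhamel 1 s v v t x := by
      intro x
      have h1 : oseenDuhamel 1 (s + t₀) u u (t + t₀) x =
          oseenDuhamel 1 (s + t₀) (fun τ => v (τ - t₀)) (fun τ => v (τ - t₀)) (t + t₀) x := by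
        refine oseenDuhamel_congr_ae_slice (fun τ hτ => ?_) x
        have hτO : τ - t₀ ∈ O := ⟨by linarith [hτ.1], by linarith [hτ.2]⟩
        have := hvuO (τ - t₀) hτO
        rw [sub_add_cancel] at this
        exact this.symm
      rw [h1]
      have h2 := oseenDuhamel_timeShift 1 (s + t₀) (fun τ => v (τ + s)) (fun τ => v (τ + s)) (t + t₀) x
      have e1 : (fun τ => (fun τ => v (τ + s)) (τ - (s + t₀))) = fun τ => v (τ - t₀) := by
        funext τ; simp only; congr 1; ring
      rw [e1] at h2
      rw [h2, show t + t₀ - (s + t₀) = t - s by ring]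
      -- `B_0(v(· + s), v(· + s))(t - s) = B_s(v, v)(t)`
      have h3 := oseenDuhamel_timeShift 1 s v v t x
      have e2 : (fun τ => v (τ - s)) = fun τ => v (τ - s) := rfl
      -- `oseenDuhamel_timeShift 1 s v v t x : B_s(v(·-s), v(·-s))(t) = B_0(v,v)(t-s)`; we need the
      -- version with `v(· + s)`: apply it to `f := v(· + s)`
      have h4 := oseenDuhamel_timeShift 1 s (fun τ => v (τ + s)) (fun τ => v (τ + s)) t x
      have e3 : (fun τ => (fun τ => v (τ + s)) (τ - s)) = v := by
        funext τ; simp only [sub_add_cancel]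
      rw [e3] at h4
      exact h4.symm
    have htt : t + t₀ - (s + t₀) = t - s := by ring
    filter_upwards [hK, hvuO t htO] with x hx hxv
    rw [hxv, hx, htt, hheat, hB x]
  exact ⟨v, π, hvcl, hvu, hbounds, hgrads, hLpb, hmemp, hO⟩

/-- **The Calderón splitting of a restarted member of Albritton's class and the energy class of
its remainder** (Albritton 2018, proof of Prop. 4.5, (4.32)–(4.33)): the classical representative
`v` of `u(· + t₀)` (`exists_classical_shift`), the long-lived factor `V` from the small-`L^∞`
part `V₀` of the splitting `v(0) = U₀ + V₀` (lifespan `> T − t₀`), and the bounds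
`∫ |v(t) − V(t)|² ≤ 4‖U₀‖₂² e^{M²t}`, `∫_{t₁}^{T−t₀} ∫ |∇(v − V)|² ≤ 4‖U₀‖₂²(1 + M²(T−t₀))e^{M²(T−t₀)}`.
[cite: Albritton2018, Prop. 4.5 proof, (4.32)–(4.33); Calderon1990] -/
theorem exists_calderon_remainder (hp₃ : 3 < p) (hp : p < ⊤) (hq₁ : 1 ≤ q) (hq : q < ⊤) (hT : 0 < T)
    (h : IsKatoBesovMildSolutionOn p q T 1 u U) {t₀ : ℝ} (ht₀ : t₀ ∈ Ioo 0 T) :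
    ∃ (v : ℝ → EuclideanSpace ℝ (Fin 3) → EuclideanSpace ℝ (Fin 3))
      (π : ℝ → EuclideanSpace ℝ (Fin 3) → ℝ)
      (V : ℝ → EuclideanSpace ℝ (Fin 3) → EuclideanSpace ℝ (Fin 3))
      (πV : ℝ → EuclideanSpace ℝ (Fin 3) → ℝ) (L M Λ₀ : ℝ),
      IsClassicalNSSolutionOn (Ioo (-(t₀ / 2)) (T - t₀)) 1 0 v π ∧
      (∀ t ∈ Ico 0 (T - t₀), v t =ᵐ[volume] u (t + t₀)) ∧
      (∀ S₁, S₁ < T - t₀ → ∃ Mv : ℝ, ∀ t ∈ Icc 0 S₁, ∀ x, ‖v t x‖ ≤ Mv) ∧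
      (∀ S₁, S₁ < T - t₀ → ∃ K : ℝ, ∀ t ∈ Icc 0 S₁, ∀ x, ‖fderiv ℝ (v t) x‖ ≤ K) ∧
      (∀ S₁, S₁ < T - t₀ → ∃ N : ℝ≥0, ∀ t ∈ Ioo 0 S₁, MemLp (v t) p volume ∧
        eLpNorm (v t) p volume ≤ N) ∧
      (∀ t ∈ Ico 0 (T - t₀), MemLp (v t) p volume) ∧
      T - t₀ < L ∧ 0 < M ∧ IsClassicalNSSolutionOn (Ioo 0 L) 1 0 V πV ∧
      (∀ t ∈ Ioo 0 L, ∀ x, ‖V t x‖ ≤ M) ∧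
      (∃ N : ℝ≥0, ∀ t ∈ Ioo 0 L, MemLp (V t) p volume ∧ eLpNorm (V t) p volume ≤ N) ∧
      (∃ C : ℝ, ∀ t ∈ Ioo 0 L, ∀ x, t ^ (1 / 2 : ℝ) * ‖fderiv ℝ (V t) x‖ ≤ C) ∧
      0 ≤ Λ₀ ∧
      (∀ t ∈ Ioo 0 (T - t₀), Integrable (fun x => ‖v t x - V t x‖ ^ 2) volume ∧
        ∫ x, ‖v t x - V t x‖ ^ 2 ≤ 4 * Λ₀ ^ 2 * Real.exp (M ^ 2 * t)) ∧
      ∀ t₁ ∈ Ioo 0 (T - t₀), ∫⁻ z in Ioo t₁ (T - t₀) ×ˢ (univ : Set (EuclideanSpace ℝ (Fin 3))),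
          ENNReal.ofReal (frobeniusNormSq (fderiv ℝ (fun y => v z.1 y - V z.1 y) z.2)) ≤
        ENNReal.ofReal (4 * Λ₀ ^ 2 * (1 + M ^ 2 * (T - t₀)) * Real.exp (M ^ 2 * (T - t₀))) := by
  obtain ⟨v, π, hvcl, hvu, hbounds, hgrads, hLpb, hmemp, hvO⟩ :=
    exists_classical_shift hp₃ hp hq₁ hq hT h ht₀
  set S : ℝ := T - t₀ with hSdef
  have hS : 0 < S := by rw [hSdef]; linarith [ht₀.2]
  have h1p : 1 < p := lt_trans (by norm_num) hp₃
  have h2p : 2 < p := lt_trans (by norm_num) hp₃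
  have h0O : (0 : ℝ) ∈ Ioo (-(t₀ / 2)) (T - t₀) := ⟨by linarith [ht₀.1], hS⟩
  -- ### the datum `a = v 0`
  have has : ContDiff ℝ (⊤ : ℕ∞) (v 0) := hvcl.contDiff_velocity h0O
  have hadiv : VectorCalculus.IsDivFree (v 0) := hvcl.divFree 0 h0O
  have hap : MemLp (v 0) p volume := hmemp 0 ⟨le_rfl, hS⟩
  obtain ⟨M₀, hM₀⟩ := hbounds (S / 2) (by linarith)
  obtain ⟨K₀, hK₀⟩ := hgrads (S / 2) (by linarith)
  have haM : ∀ x, ‖v 0 x‖ ≤ M₀ := fun x => hM₀ 0 ⟨le_rfl, by linarith⟩ x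
  have haK : ∀ x, ‖fderiv ℝ (v 0) x‖ ≤ K₀ := fun x => hK₀ 0 ⟨le_rfl, by linarith⟩ x
  -- ### the lifespan constant and the size of `V₀`
  obtain ⟨c, hc, hlong⟩ := LongLivedOseenSolution.exists_longLived_classical (p := p) hp₃ hp
  set η : ℝ := Real.sqrt (c / (S + 1)) with hηdef
  have hη : 0 < η := Real.sqrt_pos.2 (by positivity)
  have hη2 : η ^ 2 = c / (S + 1) := Real.sq_sqrt (by positivity)
  set L : ℝ := c / η ^ 2 with hLdef
  have hLS : L = S + 1 := by
    rw [hLdef, hη2, div_div_eq_mul_div, mul_div_cancel_left₀ _ hc.ne']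
  have hSL : S < L := by rw [hLS]; linarith
  -- ### the splitting
  obtain ⟨U₀, V₀, hsum, hU₀s, hU₀div, hU₀2, hU₀p, -, hV₀s, hV₀div, hV₀p, hV₀η, hV₀pη⟩ :=
    CalderonSplittingLp.exists_calderon_splitting_sup h1p hp has hap hadiv haM haK hη
  -- ### the long-lived factor
  obtain ⟨V, πV, hVcl, hVbd, hVp, hVm, hVeq, hVO, hVgrad⟩ := hlong hη hV₀s hV₀div hV₀η hV₀p
  set M : ℝ := 2 * η with hMdef
  have hM : 0 < M := by positivity
  have hNV : ∃ N : ℝ≥0, ∀ t ∈ Ioo 0 L, MemLp (V t) p volume ∧ eLpNorm (V t) p volume ≤ N := by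
    refine ⟨(2 * eLpNorm V₀ p volume).toNNReal, fun t ht => ⟨(hVp t ht).1, (hVp t ht).2.trans ?_⟩⟩
    rw [ENNReal.coe_toNNReal (ENNReal.mul_ne_top (by norm_num) hV₀p.eLpNorm_ne_top)]
  -- ### the energy class of the remainder
  set Λ₀ : ℝ := (eLpNorm U₀ 2 volume).toReal with hΛ₀def
  have hΛ₀ : 0 ≤ Λ₀ := ENNReal.toReal_nonneg
  have hWdat : (fun x => v 0 x - V₀ x) = U₀ := by
    funext x; rw [hsum x]; abel
  have hU₀' : MemLp (fun x => v 0 x - V₀ x) 2 volume := by rw [hWdat]; exact hU₀2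
  have hU₀b : eLpNorm (fun x => v 0 x - V₀ x) 2 volume ≤ ENNReal.ofReal Λ₀ := by
    rw [hWdat, hΛ₀def, ENNReal.ofReal_toReal hU₀2.eLpNorm_ne_top]
  have hE := RemainderEnergyClass.remainder_energy_class (δ₀ := t₀ / 2) hS (by linarith [ht₀.1]) hSL.le
    hvcl hvO hbounds h2p hp hLpb hVcl hM (fun t ht x => (hVbd t ht x).trans (by rw [hMdef]))
    hNV hV₀s.continuous (fun x => (hV₀η x).trans (by rw [hMdef]; linarith))
    (fun t ht => Eventually.of_forall fun x => hVeq t ht x) hVO hΛ₀ hU₀' hU₀b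
  refine ⟨v, π, V, πV, L, M, Λ₀, hvcl, hvu, hbounds, hgrads, hLpb, hmemp, hSL, hM, hVcl,
    fun t ht x => (hVbd t ht x).trans (by rw [hMdef]), hNV, hVgrad, hΛ₀, hE.1, hE.2⟩

end AlbrittonRemainderSetup

end Literature.Analysis.FluidPDE

end
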